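import Literature.NumberTheory.GaloisRepresentations.KummerGalFixing
import Mathlib.NumberTheory.NumberField.Units.Basic
import HarnessLib

/-!
# Crux `PrintCf2.SplitBadTwoRankOneOfFacts` (stmt-BirchSwinnertonDyer-20368), S3n′-FACT-FREE road, R2 brick θ-BOOKKEEPING:
# (PRO-NULL) for the TWISTED coefficients `μ_{p^M}(θ)` (`θ` quadratic) at COCYCLE LEVEL, from the untwisted statement over
# `F′ = F·K_θ`, with an explicit level shift `e` (`p^e` kills the `p`-power roots of unity of `F′`)

Cell `bsd-print-cf2`, EXTRA WIDTH seat `bsd-line-cf2-p1-w3` g13 (prover-bsd-line-cf2-p1-w3-g13-0); `--supports stmt-BirchSwinnertonDyer-20368`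
(helper, Theses-free). HONEST FRAMING: nothing here closes the crux or a registered stub; BSD is not proved by any of this; no summit
statement is proved by this seat. No definition, no named fact, no `sorry`. UNCONDITIONAL; MODEL-FREE (functions `Γ_K → K̄ˣ`, no
cohomology model chosen), any prime `p`, any sign character `ε : Γ_K →* ℤˣ`.

WHY (memos `S3N-FACTFREE-w2g14.md` §3/§7(c)/§8 and `R2-BRICKS` (-w5 g7) §3 «θ-BOOKKEEPING»). The fact-free road to (REG_W) runs through
(REG_{θ₀}) for the sign-corrected quadratic character `θ₀` (-w2 g14 §8, R5 p700990), in general `θ₀ ≠ 1`; so the level lift needs the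
pro-nullity of the dual Kummer tower with TWISTED coefficients `μ_{p^M}(θ)`, `θ = ε` a sign character: `1`-cocycles `c : U → K̄ˣ` with
`c(gh) = c(g)·(g•c(h))^{ε(g)}`. On `U′ = U ∩ ker ε = Gal(K̄/F′)`, `F′ = F·K_θ` (again abelian over `K`), such a cocycle is an ordinary Kummer
cocycle, to which (PRO-NULL)_{U′} (`KummerU.exists_level_forall_exists_pow_eq_of_galois[′]` over `F′`, p702625, read back on the cocycle by
`KummerU.kummerCocycle_pow_eq_of_pow_eq`) applies. THIS FILE is the descent along `U/U′ ≅ ℤ/2` (inflation–restriction made explicit):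
* `twistedCocycle_*` — twisted cocycles on a subgroup `U ≤ Γ_K` form a group under pointwise multiplication, closed under powers; the
  twisted coboundary `g ↦ (g•m)^{ε g}/m` is one (`twistedCoboundary_isCocycle`);
* `smul_apply_eq_of_forall_kerSign` — a twisted cocycle VANISHING on `U′ = {u ∈ U : ε u = 1}` has `U′`-INVARIANT values;
* `exists_pow_prime_pow_eq_one_of_forall_galFixing_smul_eq` — ONE `e` depending only on `F′` (`p^e ∥ #μ(F′)`, `NumberField.Units.torsionOrder`)
  such that every element of `K̄ˣ` fixed by `Gal(K̄/F′)` and killed by some `p^M` is killed by `p^e`;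
* **`twisted_pow_eq_twistedCoboundary_of_kerSign`** — THE DESCENT: if `c` is a twisted cocycle on `U` with `c^{p^N} = 1` and its restriction
  to `U′ ⊇ Gal(K̄/F′)` is the (ordinary) coboundary of some `ζ` with `ζ^{p^N} = 1`, then `c^{p^e}` is the TWISTED coboundary of `ζ^{p^e}` on `U`
  — the obstruction `c/∂ζ` takes the two values `1, a` with `a ∈ μ_{p^∞}(F′)`, killed by `p^e` (it is NOT killed by one transition in general:
  `δ_k(−1) ↦ δ_{k−1}(−1)`);
* **`twisted_proNull_of_untwisted`** — with the (PRO-NULL)_{U′} conclusion in the form `KummerU.kummerCocycle_pow_eq_of_pow_eq` delivers it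
  (`c^{p^{M−k−e}}|_{Gal(K̄/F′)} = ∂ζ`, `ζ^{p^{k+e}} = 1`): `c^{p^{M−k}}` is a twisted coboundary of a `p^k`-th root of unity on `U`. So
  (PRO-NULL)_U for `μ(θ)` holds at level `M_{F′}(k + e)`.
presearch: NSW (1.6.x) inflation–restriction; Serre Local Fields VII §6; the level-shift remark is folklore («H¹(ℤ/2, μ(F′)(θ)) has exponent 2 but
the transitions do not kill it; its values live in the fixed finite group μ_{p^∞}(F′)»); no source states it in this form; no new fact.
beyond-print theorem: no.

References: [NeukirchSchmidtWingberg2008] (1.6.6)–(1.6.7); [SerreLocalFields1979] VII §6, X §3 b); [deShalit1987] III.2.3.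
-/

noncomputable section

set_option linter.dupNamespace false
set_option autoImplicit false

open scoped Classical
open NumberField Field IntermediateField
open Literature.NumberTheory.GaloisRepresentations Literature.NumberTheory.GaloisRepresentations.LocalWeilDatum

namespace Summit.BirchSwinnertonDyer.BirchSwinnertonDyer.Theorems.PrintCf2.KummerU

variable {K : Type} [Field K]

/-! ## §1. Twisted cocycles `Γ_K ⊇ U → K̄ˣ` for a sign character `ε` — pointwise algebra -/

section Twisted

variable (U : Subgroup (absoluteGaloisGroup K)) (ε : absoluteGaloisGroup K →* ℤˣ)

/-- `ε(g)² = 1` in `ℤ` for a sign character. [folklore] -/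
theorem sign_mul_self (g : absoluteGaloisGroup K) : ((ε g : ℤˣ) : ℤ) * ((ε g : ℤˣ) : ℤ) = 1 := by
  rw [← Units.val_mul, Int.units_mul_self, Units.val_one]

/-- Products of twisted cocycles are twisted cocycles. [cite: NeukirchSchmidtWingberg2008, I §2 (cochains)] -/
theorem twistedCocycle_mul {c d : absoluteGaloisGroup K → (AlgebraicClosure K)ˣ}
    (hc : ∀ g ∈ U, ∀ h ∈ U, c (g * h) = c g * (g • c h) ^ ((ε g : ℤˣ) : ℤ))
    (hd : ∀ g ∈ U, ∀ h ∈ U, d (g * h) = d g * (g • d h) ^ ((ε g : ℤˣ) : ℤ)) :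
    ∀ g ∈ U, ∀ h ∈ U, (c * d) (g * h) = (c * d) g * (g • (c * d) h) ^ ((ε g : ℤˣ) : ℤ) := by
  intro g hg h hh
  simp only [Pi.mul_apply]
  rw [hc g hg h hh, hd g hg h hh, smul_mul', mul_zpow]
  simp only [mul_assoc, mul_left_comm]

/-- Inverses of twisted cocycles are twisted cocycles. [cite: NeukirchSchmidtWingberg2008, I §2 (cochains)] -/
theorem twistedCocycle_inv {c : absoluteGaloisGroup K → (AlgebraicClosure K)ˣ}
    (hc : ∀ g ∈ U, ∀ h ∈ U, c (g * h) = c g * (g • c h) ^ ((ε g : ℤˣ) : ℤ)) :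
    ∀ g ∈ U, ∀ h ∈ U, c⁻¹ (g * h) = c⁻¹ g * (g • c⁻¹ h) ^ ((ε g : ℤˣ) : ℤ) := by
  intro g hg h hh
  simp only [Pi.inv_apply]
  rw [hc g hg h hh, smul_inv', inv_zpow, mul_inv]

/-- Powers of twisted cocycles are twisted cocycles. [cite: NeukirchSchmidtWingberg2008, I §2 (cochains)] -/
theorem twistedCocycle_pow {c : absoluteGaloisGroup K → (AlgebraicClosure K)ˣ}
    (hc : ∀ g ∈ U, ∀ h ∈ U, c (g * h) = c g * (g • c h) ^ ((ε g : ℤˣ) : ℤ)) (n : ℕ) :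
    ∀ g ∈ U, ∀ h ∈ U, (c ^ n) (g * h) = (c ^ n) g * (g • (c ^ n) h) ^ ((ε g : ℤˣ) : ℤ) := by
  intro g hg h hh
  simp only [Pi.pow_apply]
  rw [hc g hg h hh, mul_pow, smul_pow']
  congr 1
  rw [← zpow_natCast ((g • c h) ^ ((ε g : ℤˣ) : ℤ)) n, ← zpow_mul, ← zpow_natCast (g • c h) n, ← zpow_mul, mul_comm]

/-- The **twisted coboundary** `g ↦ (g•m)^{ε g}/m` is a twisted cocycle. [cite: NeukirchSchmidtWingberg2008, I §2 (cochains)] -/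
theorem twistedCoboundary_isCocycle (m : (AlgebraicClosure K)ˣ) :
    ∀ g ∈ U, ∀ h ∈ U, (fun g ↦ (g • m) ^ ((ε g : ℤˣ) : ℤ) / m) (g * h) =
      (fun g ↦ (g • m) ^ ((ε g : ℤˣ) : ℤ) / m) g * (g • (fun g ↦ (g • m) ^ ((ε g : ℤˣ) : ℤ) / m) h) ^ ((ε g : ℤˣ) : ℤ) := by
  intro g _ h _
  simp only [map_mul, Units.val_mul, mul_smul, smul_div', smul_zpow', div_zpow, ← zpow_mul]
  rw [mul_comm ((ε h : ℤˣ) : ℤ) ((ε g : ℤˣ) : ℤ), mul_comm ((g • m) ^ ((ε g : ℤˣ) : ℤ) / m), div_mul_div_cancel]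

variable {U ε}

/-- **A twisted cocycle vanishing on `U′ = {u ∈ U : ε u = 1}` has `U′`-invariant values** (`c(ug) = u•c(g)` and `ug = g·(g⁻¹ug)` with
`g⁻¹ug ∈ U′`). [cite: NeukirchSchmidtWingberg2008, (1.6.6) (inflation)] -/
theorem smul_apply_eq_of_forall_kerSign {c : absoluteGaloisGroup K → (AlgebraicClosure K)ˣ}
    (hc : ∀ g ∈ U, ∀ h ∈ U, c (g * h) = c g * (g • c h) ^ ((ε g : ℤˣ) : ℤ))
    (hvan : ∀ u ∈ U, ε u = 1 → c u = 1) {u : absoluteGaloisGroup K} (hu : u ∈ U) (hεu : ε u = 1)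
    {g : absoluteGaloisGroup K} (hg : g ∈ U) : u • c g = c g := by
  have h1 : c (u * g) = u • c g := by
    rw [hc u hu g hg, hvan u hu hεu, one_mul, hεu, Units.val_one, zpow_one]
  have hmem : g⁻¹ * u * g ∈ U := U.mul_mem (U.mul_mem (U.inv_mem hg) hu) hg
  have hε' : ε (g⁻¹ * u * g) = 1 := by
    rw [map_mul, map_mul, map_inv, hεu, mul_one, inv_mul_cancel]
  have h2 : c (u * g) = c g := by
    rw [show u * g = g * (g⁻¹ * u * g) by group, hc g hg _ hmem, hvan _ hmem hε', smul_one, one_zpow, mul_one]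
  rw [← h1, h2]

/-- **THE DESCENT along `U/U′`.** Let `c` be a twisted cocycle on `U` killed by some `p^N`, whose restriction to `Gal(K̄/F′) ⊆ U` (on which
`ε = 1`, and which contains every `u ∈ U` with `ε u = 1`) is the ordinary coboundary `u ↦ u•ζ/ζ` of a `p`-power root of unity `ζ`. If `p^e`
kills every `p`-power root of unity of `K̄` fixed by `Gal(K̄/F′)` (i.e. of `F′`), then `c^{p^e}` is the TWISTED coboundary of `ζ^{p^e}` on `U`.
(The quotient cocycle `c/∂ζ` vanishes on `Gal(K̄/F′)`, so its values are `Gal(K̄/F′)`-invariant `p`-power roots of unity, killed by `p^e`.)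
[cite: NeukirchSchmidtWingberg2008, (1.6.6)–(1.6.7)] [cite: SerreLocalFields1979, VII §6] -/
theorem twisted_pow_eq_twistedCoboundary_of_kerSign (F' : IntermediateField K (AlgebraicClosure K)) {p e : ℕ}
    (he : ∀ a : (AlgebraicClosure K)ˣ, (∀ u ∈ galFixing K F', u • a = a) → (∃ N : ℕ, a ^ p ^ N = 1) → a ^ p ^ e = 1)
    (hU' : galFixing K F' ≤ U) (hεU' : ∀ u ∈ galFixing K F', ε u = 1)
    (hker : ∀ u ∈ U, ε u = 1 → u ∈ galFixing K F')
    {c : absoluteGaloisGroup K → (AlgebraicClosure K)ˣ}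
    (hc : ∀ g ∈ U, ∀ h ∈ U, c (g * h) = c g * (g • c h) ^ ((ε g : ℤˣ) : ℤ))
    (hcN : ∃ N : ℕ, ∀ g ∈ U, c g ^ p ^ N = 1) {ζ : (AlgebraicClosure K)ˣ} (hζN : ∃ N : ℕ, ζ ^ p ^ N = 1)
    (hres : ∀ u ∈ galFixing K F', c u = u • ζ / ζ) :
    ∀ g ∈ U, c g ^ p ^ e = (g • ζ ^ p ^ e) ^ ((ε g : ℤˣ) : ℤ) / ζ ^ p ^ e := by
  -- the quotient cocycle `c₁ = c / ∂ζ`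
  set d : absoluteGaloisGroup K → (AlgebraicClosure K)ˣ := fun g ↦ (g • ζ) ^ ((ε g : ℤˣ) : ℤ) / ζ with hd
  have hdc := twistedCoboundary_isCocycle U ε ζ
  have hc₁ : ∀ g ∈ U, ∀ h ∈ U, (c * d⁻¹) (g * h) = (c * d⁻¹) g * (g • (c * d⁻¹) h) ^ ((ε g : ℤˣ) : ℤ) :=
    twistedCocycle_mul U ε hc (twistedCocycle_inv U ε hdc)
  have hvan : ∀ u ∈ U, ε u = 1 → (c * d⁻¹) u = 1 := by
    intro u hu hεu
    have hu' := hker u hu hεu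
    simp only [Pi.mul_apply, Pi.inv_apply, hd, hres u hu', hεu, Units.val_one, zpow_one, mul_inv_cancel]
  intro g hg
  -- its value at `g` is a `Gal(K̄/F′)`-invariant `p`-power root of unity, hence killed by `p^e`
  have hinv : ∀ u ∈ galFixing K F', u • (c * d⁻¹) g = (c * d⁻¹) g := fun u hu ↦
    smul_apply_eq_of_forall_kerSign hc₁ hvan (hU' hu) (hεU' u hu) hg
  obtain ⟨N₁, hN₁⟩ := hcN
  obtain ⟨N₂, hN₂⟩ := hζN
  have hdN : d g ^ p ^ N₂ = 1 := by
    simp only [hd]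
    rw [div_pow, ← zpow_natCast ((g • ζ) ^ _), ← zpow_mul, mul_comm, zpow_mul, zpow_natCast, ← smul_pow', hN₂,
      smul_one, one_zpow, one_div, inv_one]
  have htors : ∃ N : ℕ, (c * d⁻¹) g ^ p ^ N = 1 := by
    refine ⟨N₁ + N₂, ?_⟩
    simp only [Pi.mul_apply, Pi.inv_apply]
    rw [mul_pow, inv_pow, pow_add, pow_mul, hN₁ g hg, one_pow, one_mul, mul_comm (p ^ N₁) (p ^ N₂), pow_mul, hdN, one_pow,
      inv_one]
  have hkill : ((c * d⁻¹) g) ^ p ^ e = 1 := he _ hinv htors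
  -- hence `c(g)^{p^e} = ∂ζ(g)^{p^e} = ∂(ζ^{p^e})(g)` (twisted)
  simp only [Pi.mul_apply, Pi.inv_apply, mul_pow, inv_pow, mul_inv_eq_one] at hkill
  rw [hkill, hd]
  simp only
  rw [div_pow, ← zpow_natCast ((g • ζ) ^ _), ← zpow_mul, mul_comm, zpow_mul, zpow_natCast, smul_pow']

end Twisted

/-! ## §2. The level shift: `p^e` kills the `p`-power roots of unity of a number field `F′ ⊆ K̄` -/

section Shift

variable [NumberField K]

/-- **One exponent for all levels.** For a number field `F′ ⊆ K̄` and a prime `p` there is `e` (one may take `p^e ∥ #μ(F′)`) such that every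
unit of `K̄` fixed by `Gal(K̄/F′)` and killed by some `p^N` is killed by `p^e`. [cite: NeukirchANT1999, Ch. I §7 (roots of unity of a number field)] -/
theorem exists_pow_prime_pow_eq_one_of_forall_galFixing_smul_eq (F' : IntermediateField K (AlgebraicClosure K)) [NumberField F']
    {p : ℕ} (hp : p.Prime) :
    ∃ e : ℕ, ∀ a : (AlgebraicClosure K)ˣ, (∀ u ∈ galFixing K F', u • a = a) → (∃ N : ℕ, a ^ p ^ N = 1) → a ^ p ^ e = 1 := by
  set T := NumberField.Units.torsionOrder F' with hT
  have hT0 : T ≠ 0 := (NumberField.Units.torsionOrder_pos F').ne'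
  refine ⟨T.factorization p, fun a ha hN ↦ ?_⟩
  obtain ⟨N, haN⟩ := hN
  -- `a ∈ F′`
  have ha' : ∀ g : galFixing K F', (g : absoluteGaloisGroup K) • (a : AlgebraicClosure K) = a := fun g ↦ by
    rw [← Units.coe_smul, ha g g.2]
  obtain ⟨b, hb⟩ := galFixing.exists_algebraMap_eq_of_forall_smul_eq F' ha'
  have hbN : b ^ p ^ N = 1 := by
    apply (algebraMap F' (AlgebraicClosure K)).injective
    rw [map_pow, hb, ← Units.val_pow_eq_pow_val, haN, Units.val_one, map_one]
  have hpN : p ^ N ≠ 0 := pow_ne_zero _ hp.ne_zero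
  -- `b` is an integral unit of finite order, hence killed by `T = #μ(F′)`
  have hbint : IsIntegral ℤ b := IsIntegral.of_pow (Nat.pos_of_ne_zero hpN) (by rw [hbN]; exact isIntegral_one)
  set x : 𝓞 F' := ⟨b, hbint⟩ with hx
  have hxN : x ^ p ^ N = 1 := RingOfIntegers.ext (by
    rw [RingOfIntegers.coe_eq_algebraMap, map_pow, hx, RingOfIntegers.map_mk, hbN, RingOfIntegers.coe_eq_algebraMap, map_one])
  set ζ : (𝓞 F')ˣ := Units.ofPowEqOne x (p ^ N) hxN hpN with hζ
  have hζfin : IsOfFinOrder ζ := isOfFinOrder_iff_pow_eq_one.2 ⟨p ^ N, Nat.pos_of_ne_zero hpN, Units.pow_ofPowEqOne hxN hpN⟩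
  have hζmem : ζ ∈ NumberField.Units.torsion F' := (CommGroup.mem_torsion ζ).mpr hζfin
  rw [← NumberField.Units.rootsOfUnity_eq_torsion, mem_rootsOfUnity] at hζmem
  have hbT : b ^ T = 1 := by
    have h1 := congrArg (fun u : (𝓞 F')ˣ ↦ algebraMap (𝓞 F') F' (u : 𝓞 F')) hζmem
    simp only [Units.val_pow_eq_pow_val, map_pow, hζ, Units.val_ofPowEqOne, hx, RingOfIntegers.map_mk, Units.val_one,
      map_one] at h1
    exact h1
  have haT : a ^ T = 1 := by
    apply Units.ext
    apply_fun algebraMap F' (AlgebraicClosure K) at hbT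
    rw [map_pow, hb, map_one] at hbT
    rw [Units.val_pow_eq_pow_val, hbT, Units.val_one]
  -- `a` is killed by `gcd(p^N, T) = p^j` with `p^j ∣ T`, hence by `p^{v_p(T)}`
  have hgcd : a ^ (p ^ N).gcd T = 1 := pow_gcd_eq_one.2 ⟨haN, haT⟩
  obtain ⟨j, -, hj⟩ := (Nat.dvd_prime_pow hp).1 (Nat.gcd_dvd_left (p ^ N) T)
  have hjT : p ^ j ∣ T := hj ▸ Nat.gcd_dvd_right (p ^ N) T
  have hje : j ≤ T.factorization p := (hp.pow_dvd_iff_le_factorization hT0).1 hjT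
  rw [hj] at hgcd
  rw [← Nat.add_sub_of_le hje, pow_add, pow_mul, hgcd, one_pow]

end Shift

/-! ## §3. (PRO-NULL) for the twisted coefficients from the untwisted statement over `F′` -/

section Final

/-- `β^{p^M} = y^{p^n}` (`n ≤ M`, `y ≠ 0`) ⟹ `β^{p^{M−n}}/y` is a `p^n`-th root of unity `ζ`, and the Kummer cocycle of `β` pushed by
`p^{M−n}` is the coboundary of `ζ` on the group fixing `y`. (Twin of `KummerU.kummerCocycle_pow_eq_of_pow_eq`, in `K̄ˣ`.)
[cite: SerreLocalFields1979, X §3 b)] -/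
theorem exists_unit_kummer_pow_eq {p M n : ℕ} (hnM : n ≤ M) {β y : AlgebraicClosure K} (hβ : β ≠ 0) (hy : y ≠ 0)
    (h : β ^ p ^ M = y ^ p ^ n) :
    ∃ ζ : (AlgebraicClosure K)ˣ, ζ ^ p ^ n = 1 ∧ ∀ g : absoluteGaloisGroup K, g • y = y →
      (g • Units.mk0 β hβ / Units.mk0 β hβ) ^ p ^ (M - n) = g • ζ / ζ := by
  have hζ0 : β ^ p ^ (M - n) / y ≠ 0 := div_ne_zero (pow_ne_zero _ hβ) hy
  refine ⟨Units.mk0 _ hζ0, Units.ext ?_, fun g hg ↦ Units.ext ?_⟩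
  · rw [Units.val_pow_eq_pow_val, Units.val_mk0, Units.val_one, div_pow, ← pow_mul, ← pow_add, Nat.sub_add_cancel hnM, h,
      div_self (pow_ne_zero _ hy)]
  · simp only [Units.val_pow_eq_pow_val, Units.val_div_eq_div_val, Units.coe_smul, Units.val_mk0]
    rw [div_pow, smul_div₀', smul_pow', hg, div_div_div_cancel_right₀ hy]

/-- **(PRO-NULL) FOR THE TWISTED COEFFICIENTS `μ(θ)` FROM THE UNTWISTED STATEMENT OVER `F′ = F·K_θ`.** Let `ε : Γ_K → {±1}` be a sign
character, `U ≤ Γ_K` a subgroup and `F′ ⊆ K̄` a number field with `Gal(K̄/F′) = {u ∈ U : ε u = 1}` (stated as three inclusions); let `p^e` kill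
the `p`-power roots of unity of `F′` (`exists_pow_prime_pow_eq_one_of_forall_galFixing_smul_eq`). Let `c : U → K̄ˣ` be an `ε`-twisted cocycle
killed by `p^M`, `k + e ≤ M`, whose restriction to `Gal(K̄/F′)` is the Kummer cocycle `u ↦ uβ/β` of `β` with `β^{p^M} = y^{p^{k+e}}`, `y ∈ F′ˣ` —
the conclusion of the untwisted (PRO-NULL) over `F′` at level `k + e` (`KummerU.exists_level_forall_exists_pow_eq_of_galois[′]`, p702625, for
`x′ = β^{p^M}`). Then `c^{p^{M−k}}` is the TWISTED coboundary of a `p^k`-th root of unity on `U`: «`H¹(μ_{p^M}(θ) → μ_{p^k}(θ))` kills the class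
of `c`», model-free. [cite: NeukirchSchmidtWingberg2008, (1.6.6)–(1.6.7)] [cite: SerreLocalFields1979, X §3 b)] [cite: deShalit1987, III.2.3] -/
theorem twisted_proNull_of_untwisted (F' : IntermediateField K (AlgebraicClosure K)) {p : ℕ} {e : ℕ}
    (he : ∀ a : (AlgebraicClosure K)ˣ, (∀ u ∈ galFixing K F', u • a = a) → (∃ N : ℕ, a ^ p ^ N = 1) → a ^ p ^ e = 1)
    {U : Subgroup (absoluteGaloisGroup K)} {ε : absoluteGaloisGroup K →* ℤˣ}
    (hU' : galFixing K F' ≤ U) (hεU' : ∀ u ∈ galFixing K F', ε u = 1) (hker : ∀ u ∈ U, ε u = 1 → u ∈ galFixing K F')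
    {c : absoluteGaloisGroup K → (AlgebraicClosure K)ˣ}
    (hc : ∀ g ∈ U, ∀ h ∈ U, c (g * h) = c g * (g • c h) ^ ((ε g : ℤˣ) : ℤ))
    {M k : ℕ} (hkM : k + e ≤ M) (hcM : ∀ g ∈ U, c g ^ p ^ M = 1)
    {β : AlgebraicClosure K} (hβ : β ≠ 0) (hres : ∀ u ∈ galFixing K F', (c u : AlgebraicClosure K) = u • β / β)
    {y : F'} (hy : y ≠ 0) (hβy : β ^ p ^ M = ((y : F') : AlgebraicClosure K) ^ p ^ (k + e)) :
    ∃ m : (AlgebraicClosure K)ˣ, m ^ p ^ k = 1 ∧ ∀ g ∈ U, c g ^ p ^ (M - k) = (g • m) ^ ((ε g : ℤˣ) : ℤ) / m := by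
  have hy' : ((y : F') : AlgebraicClosure K) ≠ 0 := by
    rw [Ne, ← map_zero (algebraMap F' (AlgebraicClosure K))]
    exact fun h ↦ hy ((algebraMap F' (AlgebraicClosure K)).injective h)
  obtain ⟨ζ, hζ, hζcob⟩ := exists_unit_kummer_pow_eq hkM hβ hy' hβy
  -- the pushed cocycle `c' = c^{p^{M−k−e}}`: twisted, killed by `p^{k+e}`, equal to `∂ζ` on `Gal(K̄/F′)`
  set c' : absoluteGaloisGroup K → (AlgebraicClosure K)ˣ := c ^ p ^ (M - (k + e)) with hc'def
  have hc' := twistedCocycle_pow U ε hc (p ^ (M - (k + e)))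
  have hc'N : ∃ N : ℕ, ∀ g ∈ U, c' g ^ p ^ N = 1 := ⟨k + e, fun g hg ↦ by
    rw [hc'def, Pi.pow_apply, ← pow_mul, ← pow_add, Nat.sub_add_cancel hkM, hcM g hg]⟩
  have hres' : ∀ u ∈ galFixing K F', c' u = u • ζ / ζ := by
    intro u hu
    have hcu : c u = u • Units.mk0 β hβ / Units.mk0 β hβ := Units.ext (by
      rw [hres u hu, Units.val_div_eq_div_val, Units.coe_smul, Units.val_mk0])
    have huy : u • ((y : F') : AlgebraicClosure K) = (y : F') := (mem_galFixing_iff K).1 hu _ y.2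
    rw [hc'def, Pi.pow_apply, hcu]
    exact hζcob u huy
  have key := twisted_pow_eq_twistedCoboundary_of_kerSign F' he hU' hεU' hker hc' hc'N ⟨k + e, hζ⟩ hres'
  refine ⟨ζ ^ p ^ e, ?_, fun g hg ↦ ?_⟩
  · rw [← pow_mul, ← pow_add, add_comm, hζ]
  · rw [← key g hg, Pi.pow_apply, ← pow_mul, ← pow_add]
    congr 2
    omega

end Final

end Summit.BirchSwinnertonDyer.BirchSwinnertonDyer.Theorems.PrintCf2.KummerU

end
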